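import Summits.AtomisticToContinuum.BoseEinsteinCondensation.Theorems.BECCutLineWeakDisorderTwoReplicaTransienceBoundFreeOneRatio
import Summits.AtomisticToContinuum.BoseEinsteinCondensation.Theorems.BECCutLineWeakDisorderTwoReplicaTransienceBoundFactorisation
import Summits.AtomisticToContinuum.BoseEinsteinCondensation.Theorems.BECCutLineWeakDisorderTwoReplicaTransienceBoundSandwich
import Literature.MathematicalPhysics.QuantumManyBody.OneParticleMarginals
import HarnessLib

/-!
# Crux `TwoReplicaTransienceBound` (stmt-AtomisticToContinuum-9687): free-gas case, III — the crux holds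
# for the FREE gas, with one absolute constant for every density, particle number and polymer length

Support file (does not close the item) for the crux
`Summit.AtomisticToContinuum.BoseEinsteinCondensation.Theses.BECCutLineWeakDisorder.TwoReplicaTransienceBound`
(route `BECCutLineWeakDisorder`, line `SketchIdeator1`, lead c2; dossier item E-free). For the free gas
`v ≡ 0` the `(n+1)`-line partition function factorises through the line's `stub_factorisation` and the free
tracer, `Z^{(n+1)}_T(x :: Y) = Z^{(1)}_T(x) · Z^{(n)}_T(Y)` (`tracer_free_eq_fkPartition`,
`fkPartition_vecCons_free`), so the crux's integral is, slice by slice and after the normalisation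
`Ψ_T = Z_T/‖Z_T‖₂`, the one-line participation ratio `L³∫θ_T²/(∫θ_T)²` of the Dirichlet survival profile
(`lintegral_ratio_fkWitness_free_le`; equality in the non-degenerate case), which
`…FreeOneRatio.lean` bounds by an absolute constant. Hence `twoReplicaTransienceBound_freeGas` /
registered toolbox stub `stub_freeGas`: ONE constant `C` with `∫ L³ m_T²/s_T² dY ≤ C` for `v ≡ 0`, EVERY
`ρ > 0`, EVERY `n` and EVERY `T ≥ 0` — the `v ≡ 0` instance of `TwoReplicaTransienceBound` with all its
quantifiers saturated (the crux's `ρ < ρ₀`, `∀ᶠ n`, `1 ≤ T` are idle for the free gas; the sharp constant is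
conjecturally `(π²/8)³ ≈ 1.878`, not formalised).

Reference: B. Simon, *Schrödinger semigroups*, Bull. AMS 7 (1982), §A1 (A7). [Simon1982]
-/

noncomputable section

namespace Summit.AtomisticToContinuum.BoseEinsteinCondensation.Cruxes.TwoReplicaTransienceBound.FreeGas

open MeasureTheory Filter Set
open scoped ENNReal NNReal Topology
open Literature.MathematicalPhysics.QuantumManyBody.BoseGas
open Summit.AtomisticToContinuum.BoseEinsteinCondensation.Theorems.CutLineWitness
open Summit.AtomisticToContinuum.BoseEinsteinCondensation.Cruxes.TwoReplicaTransienceBound.TracerDecoupling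

variable {n : ℕ}

/-! ### The free tracer is the one-line partition function -/

/-- `wienerPaths 1 = ⨂_{Fin 1} wienerLine` (definitional). [folklore] -/
theorem wienerPaths_one_eq : wienerPaths 1 = Measure.pi fun _ : Fin 1 => wienerLine := rfl

/-- **The free tracer is the one-line partition function** `tracer 0 L T x Y ωb = Z^{(1)}_T(x)` (no
tagged–bath action; the one-line survival event read through `(ℝ≥0 → ℝ)³ ≅ ((ℝ≥0 → ℝ)³)¹`). [folklore] -/
theorem tracer_free_eq_fkPartition (L T : ℝ) (x : Space) (Y : Config n) (ωb : PathSpace n) :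
    tracer (fun _ => 0) L T x Y ωb = fkPartition (N := 1) (fun _ => 0) L T (fun _ => x) := by
  rw [fkPartition_config_one, tracer_def]
  simp only [taggedBathAction_zero, expNeg_zero, mul_one]
  have hmp := measurePreserving_funUnique wienerLine (Fin 1)
  have hfun : ∀ ω : PathSpace 1, (fun _ : Fin 1 => (MeasurableEquiv.funUnique (Fin 1) _) ω) = ω :=
    fun ω => funext fun i => by rw [MeasurableEquiv.funUnique_apply, Subsingleton.elim i default]
  calc ∫⁻ ω₀, (survives (N := 1) L T (fun _ => x)).indicator (fun _ => (1 : ℝ≥0∞)) (fun _ => ω₀) ∂wienerLine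
      = ∫⁻ ω, (survives (N := 1) L T (fun _ => x)).indicator (fun _ => (1 : ℝ≥0∞))
          (fun _ => (MeasurableEquiv.funUnique (Fin 1) _) ω) ∂(Measure.pi fun _ : Fin 1 => wienerLine) :=
        (hmp.lintegral_comp_emb (MeasurableEquiv.measurableEmbedding _) _).symm
    _ = ∫⁻ ω, (survives (N := 1) L T (fun _ => x)).indicator 1 ω ∂(Measure.pi fun _ : Fin 1 => wienerLine) :=
        lintegral_congr fun ω => by rw [hfun]; rfl
    _ = (Measure.pi fun _ : Fin 1 => wienerLine) (survives L T fun _ => x) :=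
        lintegral_indicator_one (measurableSet_survives L T _)
    _ = wienerPaths 1 (survives L T fun _ => x) := by rw [wienerPaths_one_eq]

/-- **Free factorisation of the partition function**: for the free gas,
`Z^{(n+1)}_T(x :: Y) = Z^{(1)}_T(x) · Z^{(n)}_T(Y)` (the line's `stub_factorisation` with the free tracer
pulled out of the bath integral). [folklore] -/
theorem fkPartition_vecCons_free (L T : ℝ) (x : Space) (Y : Config n) :
    fkPartition (fun _ => 0) L T (Matrix.vecCons x Y) =
      fkPartition (N := 1) (fun _ => 0) L T (fun _ => x) * fkPartition (fun _ => 0) L T Y := by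
  rw [stub_factorisation n (fun _ => 0) measurable_const L T x Y]
  simp_rw [tracer_free_eq_fkPartition L T x Y]
  rw [lintegral_mul_const _ (measurable_fkWeight measurable_const L T Y), mul_comm]
  simp only [fkPartition, fkSemigroup, mul_one]

/-! ### The crux's integral for the free gas equals the one-line ratio -/

/-- **The free-gas cut-line functional is the one-line participation ratio** (as an inequality, valid in
all degenerate cases): for `v ≡ 0`, every `n`, `L` and `T`,
`∫ L³ m_T(Y)²/s_T(Y)² dY ≤ L³ ∫θ_T² / (∫θ_T)²`, `Ψ_T = fkWitness 0 L T 1`, `θ_T = Z^{(1)}_T`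
(free factorisation `Z(x::Y) = θ(x) Z_n(Y)`, scaling `R(cf) = c²R(f)`, `Σ_Y Z_n² = ‖Z_n‖₂²`,
`‖Z_{n+1}‖₂² = ‖θ‖₂²‖Z_n‖₂²`; equality whenever `‖Z_{n+1}‖₂² ∈ (0, ∞)`). [folklore] -/
theorem lintegral_ratio_fkWitness_free_le (n : ℕ) (L T : ℝ) :
    ∫⁻ Y : Config n, ENNReal.ofReal (L ^ 3) *
        (∫⁻ x, (‖fkWitness (N := n + 1) (fun _ => 0) L T (fun _ => (1 : ℝ≥0∞)) (Matrix.vecCons x Y)‖₊ :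
          ℝ≥0∞) ^ 2) ^ 2 /
        (∫⁻ x, (‖fkWitness (N := n + 1) (fun _ => 0) L T (fun _ => (1 : ℝ≥0∞)) (Matrix.vecCons x Y)‖₊ :
          ℝ≥0∞)) ^ 2 ≤
      ENNReal.ofReal (L ^ 3) * (∫⁻ x, fkPartition (N := 1) (fun _ => 0) L T (fun _ => x) ^ 2) /
        (∫⁻ x, fkPartition (N := 1) (fun _ => 0) L T (fun _ => x)) ^ 2 := by
  have hvm : Measurable (fun _ : ℝ => (0 : ℝ≥0∞)) := measurable_const
  obtain ⟨θ, hθ⟩ : ∃ θ : Space → ℝ≥0∞, ∀ x, θ x = fkPartition (N := 1) (fun _ => 0) L T (fun _ => x) :=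
    ⟨_, fun _ => rfl⟩
  have hθm : Measurable θ := by
    rw [show θ = fun x => fkPartition (N := 1) (fun _ => 0) L T (fun _ => x) from funext hθ]
    exact measurable_fkPartition_one hvm L T
  simp only [← hθ]
  set θ₁ := ∫⁻ x, θ x with hθ₁
  set θ₂ := ∫⁻ x, θ x ^ 2 with hθ₂
  obtain ⟨Zn, hZn⟩ : ∃ Zn : Config n → ℝ≥0∞, ∀ Y, Zn Y = fkPartition (fun _ => 0) L T Y := ⟨_, fun _ => rfl⟩
  have hZnm : Measurable Zn := by
    rw [show Zn = fun Y => fkPartition (fun _ => 0) L T Y from funext hZn]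
    exact measurable_fkSemigroup hvm L T measurable_const
  have hfac : ∀ (x : Space) (Y : Config n), fkPartition (fun _ => 0) L T (Matrix.vecCons x Y) = θ x * Zn Y :=
    fun x Y => by rw [hθ, hZn]; exact fkPartition_vecCons_free L T x Y
  set 𝒩 : ℝ≥0∞ := fkNormSq (N := n + 1) (fun _ => 0) L T (fun _ => (1 : ℝ≥0∞)) with h𝒩
  set 𝒩n : ℝ≥0∞ := ∫⁻ Y, Zn Y ^ 2 with h𝒩n
  set c : ℝ := (Real.sqrt 𝒩.toReal)⁻¹ with hc
  have hΨ : ∀ X, fkWitness (N := n + 1) (fun _ => 0) L T (fun _ => (1 : ℝ≥0∞)) X =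
      c * (fkPartition (fun _ => 0) L T X).toReal := fun X => fkWitness_one_eq _ L T X
  by_cases hc0 : c = 0
  · have h0 : ∀ X, fkWitness (N := n + 1) (fun _ => 0) L T (fun _ => (1 : ℝ≥0∞)) X = 0 := fun X => by
      rw [hΨ X, hc0, zero_mul]
    simp [h0]
  -- non-degenerate normalisation
  have hsqrt : Real.sqrt 𝒩.toReal ≠ 0 := fun h => hc0 (by rw [hc, h, inv_zero])
  have htR : 0 < 𝒩.toReal := not_le.1 fun h => hsqrt (Real.sqrt_eq_zero'.2 h)
  have h𝒩0 : 𝒩 ≠ 0 := fun h => htR.ne' (by rw [h, ENNReal.toReal_zero])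
  have h𝒩top : 𝒩 ≠ ⊤ := fun h => htR.ne' (by rw [h, ENNReal.toReal_top])
  have hc𝒩 : ENNReal.ofReal (c ^ 2) * 𝒩 = 1 := by
    have hc2 : c ^ 2 = (𝒩.toReal)⁻¹ := by rw [hc, inv_pow, Real.sq_sqrt htR.le]
    rw [hc2, ENNReal.ofReal_inv_of_pos htR, ENNReal.ofReal_toReal h𝒩top, ENNReal.inv_mul_cancel h𝒩0 h𝒩top]
  have hnn : ∀ X : Config (n + 1), (‖(fkPartition (fun _ => 0) L T X).toReal‖₊ : ℝ≥0∞) =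
      fkPartition (fun _ => 0) L T X := fun X => coe_nnnorm_toReal (fkPartition_ne_top _ L T X)
  -- slice masses of the free gas
  have hm : ∀ Y, ∫⁻ x, fkPartition (fun _ => 0) L T (Matrix.vecCons x Y) ^ 2 = θ₂ * Zn Y ^ 2 := fun Y => by
    simp_rw [hfac, mul_pow]
    rw [lintegral_mul_const _ (hθm.pow_const 2)]
  have hs : ∀ Y, ∫⁻ x, fkPartition (fun _ => 0) L T (Matrix.vecCons x Y) = θ₁ * Zn Y := fun Y => by
    simp_rw [hfac]
    rw [lintegral_mul_const _ hθm]
  -- `‖Z_{n+1}‖₂² = θ₂ · ‖Z_n‖₂²`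
  have hNorm : 𝒩 = θ₂ * 𝒩n := by
    rw [h𝒩, fkNormSq, ← lintegral_lintegral_vecCons
      ((measurable_fkSemigroup hvm L T measurable_const).pow_const 2)]
    have hpt : ∀ (x : Space) (Y : Config n),
        fkSemigroup (fun _ => 0) L T (fun _ => (1 : ℝ≥0∞)) (Matrix.vecCons x Y) ^ 2 = θ x ^ 2 * Zn Y ^ 2 :=
      fun x Y => by rw [← mul_pow, ← hfac x Y]; rfl
    simp_rw [hpt]
    rw [lintegral_lintegral_mul (hθm.pow_const 2).aemeasurable (hZnm.pow_const 2).aemeasurable]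
  have hθ₂0 : θ₂ ≠ 0 := fun h => h𝒩0 (by rw [hNorm, h, zero_mul])
  have h𝒩n0 : 𝒩n ≠ 0 := fun h => h𝒩0 (by rw [hNorm, h, mul_zero])
  have hθ₂t : θ₂ ≠ ⊤ := fun h => h𝒩top (by rw [hNorm, h, ENNReal.top_mul h𝒩n0])
  have h𝒩nt : 𝒩n ≠ ⊤ := fun h => h𝒩top (by rw [hNorm, h, ENNReal.mul_top hθ₂0])
  -- slice by slice: `L³ (θ₂ Z²)²/(θ₁ Z)² ≤ L³ (θ₂²/θ₁²) Z²`
  have hslice : ∀ Y, ENNReal.ofReal (L ^ 3) * (θ₂ * Zn Y ^ 2) ^ 2 / (θ₁ * Zn Y) ^ 2 ≤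
      ENNReal.ofReal (L ^ 3) * (θ₂ ^ 2 / θ₁ ^ 2) * Zn Y ^ 2 := by
    intro Y
    rcases eq_or_ne (Zn Y) 0 with hZ0 | hZ0
    · simp [hZ0]
    have hZt : Zn Y ^ 2 ≠ ⊤ := ENNReal.pow_ne_top (by rw [hZn]; exact fkPartition_ne_top _ L T Y)
    have hZ20 : Zn Y ^ 2 ≠ 0 := pow_ne_zero _ hZ0
    have e : (θ₂ * Zn Y ^ 2) ^ 2 / (θ₁ * Zn Y) ^ 2 = θ₂ ^ 2 * Zn Y ^ 2 / θ₁ ^ 2 := by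
      rw [show (θ₂ * Zn Y ^ 2) ^ 2 = θ₂ ^ 2 * Zn Y ^ 2 * Zn Y ^ 2 by ring,
        show (θ₁ * Zn Y) ^ 2 = θ₁ ^ 2 * Zn Y ^ 2 by ring, ENNReal.mul_div_mul_right _ _ hZ20 hZt]
    rw [mul_div_assoc, e]
    apply le_of_eq
    simp only [div_eq_mul_inv]
    ring
  -- integrate in `Y`
  simp_rw [hΨ]
  rw [lintegral_ratio_const_mul L (fun X => (fkPartition (fun _ => 0) L T X).toReal) hc0]
  simp_rw [hnn, hm, hs]
  calc ENNReal.ofReal (c ^ 2) * ∫⁻ Y, ENNReal.ofReal (L ^ 3) * (θ₂ * Zn Y ^ 2) ^ 2 / (θ₁ * Zn Y) ^ 2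
      ≤ ENNReal.ofReal (c ^ 2) * ∫⁻ Y, ENNReal.ofReal (L ^ 3) * (θ₂ ^ 2 / θ₁ ^ 2) * Zn Y ^ 2 :=
        mul_le_mul' le_rfl (lintegral_mono hslice)
    _ = ENNReal.ofReal (c ^ 2) * (ENNReal.ofReal (L ^ 3) * (θ₂ ^ 2 / θ₁ ^ 2) * 𝒩n) := by
        rw [lintegral_const_mul _ (hZnm.pow_const 2)]
    _ = ENNReal.ofReal (L ^ 3) * θ₂ / θ₁ ^ 2 * (ENNReal.ofReal (c ^ 2) * (θ₂ * 𝒩n)) := by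
        simp only [div_eq_mul_inv]
        ring
    _ = ENNReal.ofReal (L ^ 3) * θ₂ / θ₁ ^ 2 := by rw [← hNorm, hc𝒩, mul_one]

/-- **`TwoReplicaTransienceBound` holds for the FREE gas, uniformly in EVERYTHING**: there is an absolute
constant `C` such that for `v ≡ 0`, every density `ρ > 0`, every particle number `n` and every `T ≥ 0`,
`∫ L³ m_T(Y)²/s_T(Y)² dY ≤ C` for `Ψ_T = fkWitness 0 L T 1`, `L = sideLength ρ (n+1)` (reduction to the
one-line ratio `lintegral_ratio_fkWitness_free_le` and its absolute bound `free_ratio_le`; the sharp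
constant is conjecturally `(π²/8)³ ≈ 1.878`, not formalised). [folklore] -/
theorem twoReplicaTransienceBound_freeGas : ∃ C : ℝ, 0 < C ∧ ∀ ρ : ℝ, 0 < ρ → ∀ (n : ℕ) (T : ℝ), 0 ≤ T →
    ∫⁻ Y : Config n, ENNReal.ofReal (sideLength ρ (n + 1) ^ 3) *
        (∫⁻ x, (‖fkWitness (N := n + 1) (fun _ => 0) (sideLength ρ (n + 1)) T (fun _ => (1 : ℝ≥0∞))
          (Matrix.vecCons x Y)‖₊ : ℝ≥0∞) ^ 2) ^ 2 /
        (∫⁻ x, (‖fkWitness (N := n + 1) (fun _ => 0) (sideLength ρ (n + 1)) T (fun _ => (1 : ℝ≥0∞))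
          (Matrix.vecCons x Y)‖₊ : ℝ≥0∞)) ^ 2 ≤ ENNReal.ofReal C := by
  obtain ⟨C, hCt, hC⟩ := free_ratio_le
  refine ⟨C.toReal + 1, by positivity, fun ρ hρ n T hT => ?_⟩
  have hL : 0 < sideLength ρ (n + 1) :=
    Real.rpow_pos_of_pos (div_pos (by exact_mod_cast Nat.succ_pos n) hρ) _
  calc _ ≤ ENNReal.ofReal (sideLength ρ (n + 1) ^ 3) *
          (∫⁻ x, fkPartition (N := 1) (fun _ => 0) (sideLength ρ (n + 1)) T (fun _ => x) ^ 2) /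
          (∫⁻ x, fkPartition (N := 1) (fun _ => 0) (sideLength ρ (n + 1)) T (fun _ => x)) ^ 2 :=
        lintegral_ratio_fkWitness_free_le n _ T
    _ ≤ C := hC (fun _ => 0) measurable_const _ hL T hT
    _ = ENNReal.ofReal C.toReal := (ENNReal.ofReal_toReal hCt).symm
    _ ≤ ENNReal.ofReal (C.toReal + 1) := ENNReal.ofReal_le_ofReal (by linarith)

end Summit.AtomisticToContinuum.BoseEinsteinCondensation.Cruxes.TwoReplicaTransienceBound.FreeGas

namespace Summit.AtomisticToContinuum.BoseEinsteinCondensation.Cruxes.TwoReplicaTransienceBound.TracerDecoupling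

open Literature.MathematicalPhysics.QuantumManyBody.BoseGas

/-- **Registered toolbox stub `stub_freeGas`** (crux stmt-AtomisticToContinuum-9687, line `SketchIdeator1`):
the crux's integral for the FREE gas `v ≡ 0` is bounded by ONE absolute constant for every density, every
particle number and every `T ≥ 0` (`= FreeGas.twoReplicaTransienceBound_freeGas`). -/
theorem stub_freeGas :
    ∃ C : ℝ, 0 < C ∧ ∀ (ρ : ℝ), 0 < ρ → ∀ (n : ℕ) (T : ℝ), 0 ≤ T →
      ∫⁻ Y : Config n, ENNReal.ofReal (sideLength ρ (n + 1) ^ 3) *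
          (∫⁻ x, (‖@fkWitness (n + 1) (fun _ => 0) (sideLength ρ (n + 1)) T (fun _ => (1 : ENNReal))
            (Matrix.vecCons x Y)‖₊ : ENNReal) ^ 2) ^ 2 /
          (∫⁻ x, (‖@fkWitness (n + 1) (fun _ => 0) (sideLength ρ (n + 1)) T (fun _ => (1 : ENNReal))
            (Matrix.vecCons x Y)‖₊ : ENNReal)) ^ 2 ≤ ENNReal.ofReal C :=
  FreeGas.twoReplicaTransienceBound_freeGas

end Summit.AtomisticToContinuum.BoseEinsteinCondensation.Cruxes.TwoReplicaTransienceBound.TracerDecoupling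

end
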